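import Mathlib.NumberTheory.NumberField.CMField
import Literature.NumberTheory.Automorphic.ClozelAlgebraicity
import HarnessLib

/-!
# Patrikis: the infinity type of a regular algebraic cuspidal representation descends to `F_cm`
(Patrikis 2019, Prop. 2.4.7 with Rem. 2.4.8 (1); named fact, D-0014)

Topic `NumberTheory/Automorphic`, on the carriers of `AutomorphicRepsGL` / `InfinityType`
(`CuspidalAutomorphicRepData n F hcpt`, `AutomorphicRepData.HasInfinityType`, `InfinityType F n`
with weights `(a, b) ↔ z ↦ z^a z̄^b`, `IsRegular`, `IsCAlgebraic`, `IsLAlgebraic`). Requested as the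
literature behind the crux `InfinityTypeDescent` of route `Langlands/SelfDefeatingInduction`
(this fact grounds `Summit.Langlands.Langlands.Theses.SelfDefeatingInduction.InfinityTypeDescent`).

## Source, as printed

S. Patrikis, *Variations on a theorem of Tate*, Mem. Amer. Math. Soc. 258 (2019), no. 1238
(= arXiv:1207.6724) [Patrikis2019], §2.4 (Memoirs numbering, the one used by the route; in the held
arXiv text, `paper:arxiv-1207.6724` chunk 24, this is §3.2 with Thm. 3.2.1 / Cor. 3.2.3, the numbering
cited by `ClozelAlgebraicity`; read 2026-08-15):

* (setting, first paragraph of the section) "Take `G = GL_n/F` and, for simplicity, `F` to be totally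
  imaginary. We collect the data of `π`'s archimedean `L`-parameters as `M = {μ_ι}_ι`, which we will
  loosely refer to as the 'infinity-type' of `π`."; `F_cm` is "the maximal CM subfield of `F`"
  (chunk 18, Weil's descent lemma for type-A Hecke characters), where (conventions, chunk 11) "By a
  CM field we mean as usual a quadratic totally imaginary extension of a totally real field; these,
  and their real subfields, are the number fields on which complex conjugation is well-defined".
* **Theorem (Théorème 3.13 of [Clozel])** opening the section — tree: `Clozel1990_regularAlgebraic`
  (`ClozelAlgebraicity`) —, the **Hypothesis** following it ("`π` is an isobaric C- or L-algebraic
  automorphic representation of `GL_n(𝔸_F)` satisfying the conclusion of Clozel's theorem"), and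
  **Corollary 2.4.6** ("The field `ℚ(π_f)` is CM").
* **Proposition 2.4.7** (`cmdescent`). "Let `π` be as in Hypothesis [above]. […] Then the
  infinity-type of `π` descends to `F_cm`."  Proof (printed in full): `E` = Galois closure of
  `ℚ(π_f)` is CM; for two embeddings `ι, ι' : F → ℂ` above the same embedding of
  `F ∩ (F̃)_cm = F_cm` there is `σ ∈ Aut(ℂ/E)` with `ι' = σ⁻¹ι` (the `σ ∈ Aut(ℂ/E)` act transitively on
  the embeddings of `F` above a fixed embedding of `F_cm`), and `^σπ ≅ π` gives `^σM = M`, i.e.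
  `μ_ι = μ_{σ⁻¹ι} = μ_{ι'}`.
* **Remark 2.4.8 (1).** "If `π` is regular, this yields an unconditional descent result for its
  infinity-type" (the Hypothesis holds for regular C- or L-algebraic cuspidal `π` by Clozel's
  theorem; "the L-algebraic analogue follows easily by twisting").  (Rem. 2.4.8 (2) — for `F` CM and
  `π` regular algebraic cuspidal, `π = Ind_L^F(π₀)` forces `L` CM — is NOT vendored here: it is the
  automorphic-induction consequence the route proves as `RegularInductionForcesCM`.)

So the unconditional printed theorem is: **for `F` totally imaginary and `π` a cuspidal automorphic
representation of `GL_n(𝔸_F)` that is regular and C- or L-algebraic, `μ_ι` depends only on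
`ι|_{F_cm}`.**

## Rendering (what is weaker than print, and why it is faithful)

* *Infinity type.* The tree reads the archimedean parameter of `π` only through
  `AutomorphicRepData.HasInfinityType T` (the multisets `{a_i}` of `z`-exponents at each
  `ι : F →+* ℂ`, i.e. the Harish-Chandra parameter; the pairing `(a_i, b_i)` is not read, D3 of
  `AutomorphicRepsGL`). "`μ_ι = μ_{ι'}`" is rendered on these multisets:
  `(T ι).map a = (T ι').map a` — implied by, hence at most as strong as, equality of the full
  parameters (and it recovers the `b`-multisets too: by well-formedness `{b at ι} = {a at c ∘ ι}`, and
  `c ∘ ι`, `c ∘ ι'` again agree on `F_cm`). "Regular" and "C- or L-algebraic" are the predicates of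
  `InfinityType` on an infinity type `T` of `π` (`IsRegular`; `IsCAlgebraic ∨ IsLAlgebraic`), exactly
  as in the accepted `AutomorphicRepData.IsRegularAlgebraic / IsLAlgebraic / IsCAlgebraic`
  (`∃ T, HasInfinityType T ∧ …`); the statement is made for every such `T`.
* *`ι|_{F_cm} = ι'|_{F_cm}`.* The tree has no "maximal CM subfield". With Patrikis's convention (CM
  *or totally real* = "complex conjugation well-defined") the subfields `M ≤ F` that are CM or totally
  real form a directed family (composita of such fields are again such) whose largest member is
  `F_cm`; hence "`ι` and `ι'` agree on `F_cm`" ⇔ "`ι` and `ι'` agree on every subfield `M ≤ F` that is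
  CM or totally real" (Mathlib `NumberField.IsCMField`, `NumberField.IsTotallyReal` on `↥M`). This is
  the hypothesis used below — an equivalent reformulation, not a strengthening.
* *Totally imaginary* = Mathlib `NumberField.IsTotallyComplex` (no real places). `F : Type` (universe
  `0`) is forced by `CuspidalAutomorphicRepData`.
* Nothing here duplicates a tree declaration (`lean search 'cmDescent|maximal CM|F_cm|InfinityTypeDescent'`:
  only the route item). The proof inputs exist in the tree as `Clozel1990_regularAlgebraic`
  (Clozel Thm. 3.13 + Cor. 2.4.6), so a literature-prover can DISCHARGE this fact by Patrikis's Galois-theory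
  argument (extension of automorphisms of `ℚ̄` to `ℂ`; transitivity on `Hom_{F_cm}(F, ℂ)`).

## References

* [Patrikis2019] S. Patrikis, *Variations on a theorem of Tate*, Mem. AMS 258 (2019), no. 1238,
  §2.4: Cor. 2.4.6, Prop. 2.4.7, Rem. 2.4.8 (held: arXiv:1207.6724, §3.2, chunk 24).
* [Clozel1990] L. Clozel, *Motifs et formes automorphes*, Perspect. Math. 10 (1990), Thm. 3.13.
-/

noncomputable section

open scoped Classical
open NumberField IsDedekindDomain

namespace Literature.NumberTheory.Automorphic

/-- **Patrikis 2019, Prop. 2.4.7 with Rem. 2.4.8 (1): CM descent of the infinity type of a regular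
algebraic cuspidal representation** (named fact, D-0014). For every totally imaginary number field
`F`, every `n`, every cuspidal automorphic representation `π` of `GL_n(𝔸_F)` and every infinity type
`T` of `π` (`HasInfinityType`: `T` carries the archimedean parameter of `π`) which is regular and C- or
L-algebraic: if two embeddings `ι ι' : F →+* ℂ` agree on `F_cm` — rendered: agree on every subfield
`M ≤ F` that is CM or totally real (these have `F_cm` as largest member) — then the multisets of
`z`-exponents of `T` at `ι` and at `ι'` coincide ("the infinity-type of `π` descends to `F_cm`";
unconditional in the regular case by Clozel's Thm. 3.13 = `Clozel1990_regularAlgebraic`).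
Grounds `Summit.Langlands.Langlands.Theses.SelfDefeatingInduction.InfinityTypeDescent` (the item is
this fact verbatim). [cite: Patrikis2019, Prop. 2.4.7 and Rem. 2.4.8 (1) (Mem. AMS numbering; arXiv:1207.6724 §3.2)] -/
def Patrikis2019_cmDescent : Prop :=
  ∀ (F : Type) [Field F] [NumberField F], IsTotallyComplex F →
    ∀ (n : ℕ) (hcpt : isCompact_glFiniteIntegralLevel n F) (π : CuspidalAutomorphicRepData n F hcpt)
      (T : InfinityType F n), π.1.HasInfinityType T → T.IsRegular → (T.IsCAlgebraic ∨ T.IsLAlgebraic) →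
      ∀ ι ι' : F →+* ℂ,
        (∀ M : Subfield F, (IsCMField M ∨ IsTotallyReal M) → ∀ x ∈ M, ι x = ι' x) →
        (T ι).map ArchWeight.a = (T ι').map ArchWeight.a

/-- Unfolding lemma for `Patrikis2019_cmDescent`. [folklore] -/
theorem Patrikis2019_cmDescent_iff :
    Patrikis2019_cmDescent ↔
      ∀ (F : Type) [Field F] [NumberField F], IsTotallyComplex F →
        ∀ (n : ℕ) (hcpt : isCompact_glFiniteIntegralLevel n F)
          (π : CuspidalAutomorphicRepData n F hcpt) (T : InfinityType F n),
          π.1.HasInfinityType T → T.IsRegular → (T.IsCAlgebraic ∨ T.IsLAlgebraic) →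
          ∀ ι ι' : F →+* ℂ,
            (∀ M : Subfield F, (IsCMField M ∨ IsTotallyReal M) → ∀ x ∈ M, ι x = ι' x) →
            (T ι).map ArchWeight.a = (T ι').map ArchWeight.a :=
  Iff.rfl

/-- Under the fact, the **regular algebraic** case in the tree's packaging: for `π` cuspidal on
`GL_n(𝔸_F)`, `F` totally imaginary, and `T` a regular algebraic (`IsRegularAlgebraic` = C-algebraic
and regular, Clozel Déf. 1.8/3.12) infinity type of `π`, the `a`-multisets of `T` agree at any two
embeddings agreeing on every CM-or-totally-real subfield. [cite: Patrikis2019, Rem. 2.4.8 (1)] -/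
theorem Patrikis2019_cmDescent.of_isRegularAlgebraic (h : Patrikis2019_cmDescent)
    {F : Type} [Field F] [NumberField F] (hF : IsTotallyComplex F) {n : ℕ}
    {hcpt : isCompact_glFiniteIntegralLevel n F} (π : CuspidalAutomorphicRepData n F hcpt)
    {T : InfinityType F n} (hT : π.1.HasInfinityType T) (hreg : T.IsRegularAlgebraic)
    {ι ι' : F →+* ℂ}
    (hιι' : ∀ M : Subfield F, (IsCMField M ∨ IsTotallyReal M) → ∀ x ∈ M, ι x = ι' x) :
    (T ι).map ArchWeight.a = (T ι').map ArchWeight.a :=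
  h F hF n hcpt π T hT hreg.2 (Or.inl hreg.1) ι ι' hιι'

/-- Under the fact, the hypothesis is symmetric in the two embeddings, so the conclusion can be
used in either direction (bookkeeping for consumers summing over the embeddings above a fixed one).
[folklore] -/
theorem Patrikis2019_cmDescent.symm_apply (h : Patrikis2019_cmDescent)
    {F : Type} [Field F] [NumberField F] (hF : IsTotallyComplex F) {n : ℕ}
    {hcpt : isCompact_glFiniteIntegralLevel n F} (π : CuspidalAutomorphicRepData n F hcpt)
    {T : InfinityType F n} (hT : π.1.HasInfinityType T) (hreg : T.IsRegular)
    (halg : T.IsCAlgebraic ∨ T.IsLAlgebraic) {ι ι' : F →+* ℂ}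
    (hιι' : ∀ M : Subfield F, (IsCMField M ∨ IsTotallyReal M) → ∀ x ∈ M, ι x = ι' x) :
    (T ι').map ArchWeight.a = (T ι).map ArchWeight.a :=
  (h F hF n hcpt π T hT hreg halg ι ι' hιι').symm

end Literature.NumberTheory.Automorphic
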